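import Summits.BirchSwinnertonDyer.BirchSwinnertonDyer.Theorems.Rank2Observatory2DescClPrimesOver
import HarnessLib

/-!
# BirchSwinnertonDyer — rank ≥ 2 observatory: class-group-general 2-descent, inert primes (N8)

HONEST FRAMING: per-curve certified theorems and census instruments; no claim on BSD in rank ≥ 2.

Generic glue of the KERNEL-2DESC-CL instrument (design `b2b-bsdr2-cert-1/KERNEL-2DESC-CL.md`):
for a monic irreducible integer cubic `f` with root `θ`, `K = ℚ(θ)`, and a rational prime `p` not
dividing the index `[𝓞 K : ℤ[θ]]` such that `f` has no root modulo `p`, the ideal `(p)` of `𝓞 K`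
is prime (the unique prime above `p`, Dedekind–Kummer) of norm `p³`. This is the presentation of the
INERT registry primes of the per-field files (a `HeightOneSpectrum` term plus its covering
statement). Sorry-free; axioms `propext`, `Classical.choice`, `Quot.sound`.
[cite: Marcus2018, Ch. 3, Thm. 27]
-/

-- single-conjunct summit: `Summit.BirchSwinnertonDyer.BirchSwinnertonDyer.…` repeats the name by design
set_option linter.dupNamespace false

noncomputable section

open scoped Classical NumberField nonZeroDivisors

namespace Summit.BirchSwinnertonDyer.BirchSwinnertonDyer.Rank2Observatory.TwoDescCl

open IsDedekindDomain NumberField Ideal Polynomial Module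
open Literature.NumberTheory.NumberFields Literature.NumberTheory.NumberFields.MonicCubic

variable {K : Type*} [Field K] [NumberField K] {a b c : ℤ} {θ : K}

/-- **Inert primes.** If `f = X³ + aX² + bX + c` has no root modulo the prime `p` and
`p ∤ [𝓞 K : ℤ[θ]]`, then `(p) ⊂ 𝓞 K` is a prime above `p` of norm `p³`, and it is the only prime
of `𝓞 K` containing `p`. [cite: Marcus2018, Ch. 3, Thm. 27] -/
theorem primesOver_inert (hirr : Irreducible (polyQ a b c)) (hθ : aeval θ (poly a b c) = 0)
    (h3 : finrank ℚ K = 3) {p : ℕ} (hp : p.Prime)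
    (hexp : ¬ p ∣ RingOfIntegers.exponent (thetaInt hθ))
    (hnr : ∀ r : ZMod p, r ^ 3 + (a : ZMod p) * r ^ 2 + (b : ZMod p) * r + (c : ZMod p) ≠ 0) :
    (span {(p : 𝓞 K)} ∈ primesOver (span {(p : ℤ)}) (𝓞 K) ∧
        absNorm (span {(p : 𝓞 K)}) = p ^ 3) ∧
      ∀ P : Ideal (𝓞 K), P.IsPrime → (p : 𝓞 K) ∈ P → P = span {(p : 𝓞 K)} := by
  haveI hpz : (span {(p : ℤ)}).IsMaximal :=
    ((span_singleton_prime (by exact_mod_cast hp.ne_zero)).mpr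
      (Nat.prime_iff_prime_int.mp hp)).isMaximal (by simp [hp.ne_zero])
  have hcov : ∀ P : Ideal (𝓞 K), P.IsPrime → (p : 𝓞 K) ∈ P → P = span {(p : 𝓞 K)} :=
    fun P hP hpP => eq_span_of_no_root' hirr hθ hp hexp (mem_primesOver_of_mem hP hp hpP) hnr
  obtain ⟨Q, hQmax, hQover⟩ :=
    exists_maximal_ideal_liesOver_of_isIntegral (S := 𝓞 K) (span {(p : ℤ)})
  have hQ : Q ∈ primesOver (span {(p : ℤ)}) (𝓞 K) := ⟨hQmax.isPrime, hQover⟩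
  have hQeq : Q = span {(p : 𝓞 K)} := eq_span_of_no_root' hirr hθ hp hexp hQ hnr
  refine ⟨⟨hQeq ▸ hQ, ?_⟩, hcov⟩
  rw [absNorm_span_singleton, ← map_natCast (algebraMap ℤ (𝓞 K)) p, Algebra.norm_algebraMap,
    NumberField.RingOfIntegers.rank, h3]
  simp [Int.natAbs_pow]

omit [NumberField K] in
/-- The inert prime `(p)` as a point of the height-one spectrum is determined by `p`: every `v`
containing `p` is the `v₀` with `v₀.asIdeal = (p)`. [cite: Marcus2018, Ch. 3, Thm. 27] -/
theorem heightOneSpectrum_eq_of_inert {p : ℕ} {I : Ideal (𝓞 K)}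
    (hcov : ∀ P : Ideal (𝓞 K), P.IsPrime → (p : 𝓞 K) ∈ P → P = I)
    (v₀ : HeightOneSpectrum (𝓞 K)) (h₀ : v₀.asIdeal = I) (v : HeightOneSpectrum (𝓞 K))
    (hv : (p : 𝓞 K) ∈ v.asIdeal) : v = v₀ :=
  HeightOneSpectrum.ext (by rw [h₀]; exact hcov _ v.isPrime hv)

end Summit.BirchSwinnertonDyer.BirchSwinnertonDyer.Rank2Observatory.TwoDescCl

end
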